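import Mathlib
import Literature.LinearAlgebra.Matrix.CyclicBlockDeterminant
import Literature.MathematicalPhysics.QuantumLattice.GrassmannGaussianPairing
import Summits.ValiantsHypothesis.ValiantsHypothesis.Theorems.SymmetroidDescartesDerivedPencilRolleWalkDefs

/-!
# Route SymmetroidDescartes — refutation of `DerivedPencilRolle` (stmt-ValiantsHypothesis-18500):
path determinant — an affine matrix `I − Z₀ − W·u vᵀ` whose determinant on the monomial curve is `1 − W·pathSum`

Helper file of the line `staircase-refutation` (crux stmt-ValiantsHypothesis-18500): proves the
registered stub `stub_walkDet` of the refutation skeleton `not_DerivedPencilRolle`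
(Cruxes/DerivedPencilRolle/Lines/staircase_refutation.lean).

Construction (`T = g.length`): index `V × Fin (T+1)`, reindexed to `Fin ((T+1)·|V|)`; the matrix is the
unipotent cyclic block-bidiagonal `1 + cyclicSub X` of
`Literature.LinearAlgebra.Matrix.CyclicBlockDeterminant`, with the polynomial layer matrices
(entries `C((-1)^neg η^a) * X cls`) as blocks in reversed time order and the rank-one corner block
`X 0 = 𝟙 · (−(−1)^T W · e_{v₀})ᵀ` (entries `C _`), so all entries are affine.  After
`MvPolynomial.eval` on the monomial curve, `det_one_add_cyclicSub` gives
`det = det (1 + (−1)^T X_T ⋯ X_1 X_0)` with `X_T ⋯ X_1` the product of the real layer matrices, and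
the rank-one update `det (1 + a bᵀ) = 1 + bᵀ a` (`Matrix.det_one_add_mul_comm`) yields
`1 − W · Σ_x (L_0 ⋯ L_{T-1})_{v₀ x} = 1 − W · pathSum`.
-/

-- single-conjunct layout: Sub = Summit, duplicated namespace component intended
set_option linter.dupNamespace false

namespace Summit.ValiantsHypothesis.ValiantsHypothesis.Theorems.SymmetroidDescartes.DPR

open scoped BigOperators
open Literature.LinearAlgebra.Matrix (cyclicSub cyclicSub_apply det_one_add_cyclicSub
  reverse_prod_ofFn_succ)

/-! ### The path determinant (`stub_walkDet`)

We realise `1 − W · pathSum` as the determinant of the unipotent cyclic block-bidiagonal matrix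
`1 + cyclicSub X` on `V × Fin (T+1)` (`T = g.length`), whose blocks are the polynomial layer
matrices in reversed time order (`X (i+1)` = layer `T-1-i`, entries `C(± η^a) · X_cls`) and the
rank-one corner block `X 0 = (−(−1)^T W) · 𝟙 · e_{v₀}ᵀ` (entries `C _`), reindexed to
`Fin ((T+1)·|V|)`.  By `det_one_add_cyclicSub` (Literature) the determinant is
`det (1 + (−1)^T X_T ⋯ X_1 X_0)`;
after evaluation on the monomial curve `X_T ⋯ X_1` is the product of the layer matrices and the
rank-one corner turns the determinant into `1 − W · Σ_x (L_0 ⋯ L_{T-1})_{v₀ x}`. -/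

/-- Reversed enumeration of a list through `Fin.rev` followed by `reverse` is `map`. [folklore] -/
theorem walkDet_ofFn_rev_get {α β : Type*} (g : List α) (F : α → β) :
    (List.ofFn fun i : Fin g.length => F (g.get (Fin.rev i))).reverse = g.map F := by
  rw [Literature.MathematicalPhysics.QuantumLattice.reverse_ofFn]
  simp only [Function.comp_def, Fin.rev_rev]
  rw [List.ofFn_comp', List.ofFn_get]

/-- A ring homomorphism applied entrywise to `1 + cyclicSub X` acts block by block. [folklore] -/
theorem walkDet_map_one_add_cyclicSub {σ : Type*} [DecidableEq σ] {R S : Type*} [CommRing R]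
    [CommRing S] (f : R →+* S) {k : ℕ} (X : Fin (k + 1) → Matrix σ σ R) :
    (1 + cyclicSub X).map f = 1 + cyclicSub fun t => (X t).map f := by
  ext ⟨i, t⟩ ⟨j, s⟩
  simp only [Matrix.map_apply, Matrix.add_apply, Matrix.one_apply, cyclicSub_apply, map_add,
    Prod.mk.injEq]
  split_ifs <;> simp

/-- The entries of `1 + cyclicSub X` are affine when the entries of the blocks are. [folklore] -/
theorem walkDet_totalDegree_le {σ : Type*} [DecidableEq σ] {K k : ℕ}
    (X : Fin (k + 1) → Matrix σ σ (MvPolynomial (Fin K) ℝ))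
    (hX : ∀ t i j, (X t i j).totalDegree ≤ 1) (p q : σ × Fin (k + 1)) :
    ((1 + cyclicSub X) p q).totalDegree ≤ 1 := by
  obtain ⟨i, t⟩ := p
  obtain ⟨j, s⟩ := q
  rw [Matrix.add_apply, cyclicSub_apply, Matrix.one_apply]
  refine (MvPolynomial.totalDegree_add _ _).trans (max_le ?_ ?_)
  · split_ifs <;> simp
  · split_ifs
    · exact hX _ _ _
    · simp

/-- Determinant of the unipotent cyclic matrix with a rank-one corner block
`X 0 = 𝟙 · (c · e_{v₀})ᵀ`:
`det (1 + cyclicSub X) = 1 + (−1)^k · c · Σ_x (X_k ⋯ X_1)_{v₀ x}`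
(the cyclic block determinant followed by the rank-one update `det (1 + a bᵀ) = 1 + bᵀ a`).
[folklore] -/
theorem walkDet_det_cyclic {σ : Type*} [Fintype σ] [DecidableEq σ] {k : ℕ}
    (X : Fin (k + 1) → Matrix σ σ ℝ) (P : Matrix σ σ ℝ) (v₀ : σ) (c : ℝ)
    (h0 : X 0 = Matrix.of fun _ v' => if v' = v₀ then c else 0)
    (h : (List.ofFn fun i : Fin k => X i.succ).reverse.prod = P) :
    (1 + cyclicSub X).det = 1 + (-1 : ℝ) ^ k * c * ∑ x, P v₀ x := by
  rw [det_one_add_cyclicSub, reverse_prod_ofFn_succ, h, h0]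
  set A : Matrix σ (Fin 1) ℝ := Matrix.of fun y _ => ∑ x, P y x with hA
  set B : Matrix (Fin 1) σ ℝ := Matrix.of fun _ v' => if v' = v₀ then (-1 : ℝ) ^ k * c else 0
    with hB
  have hAB :
      (-1 : ℝ) ^ k • (P * Matrix.of fun _ v' => if v' = v₀ then c else 0) = A * B := by
    ext y v'
    simp only [Matrix.smul_apply, Matrix.mul_apply, Matrix.of_apply, hA, hB, Fin.sum_univ_one,
      smul_eq_mul]
    by_cases hv : v' = v₀
    · simp only [hv, ↓reduceIte, ← Finset.sum_mul]
      ring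
    · simp [hv]
  rw [hAB, Matrix.det_one_add_mul_comm, Matrix.det_fin_one]
  simp [Matrix.mul_apply, hA, hB]

/-- On the monomial curve `X_l ↦ t^(d l)` the polynomial edge label `C(± η^a) · X_cls`
evaluates to the step value. [folklore] -/
theorem walkDet_eval_stepPoly {K : ℕ} (d : Fin K → ℕ) (η t : ℝ) (o : Option (WEdge K)) :
    MvPolynomial.eval (fun l => t ^ d l)
        (o.elim 0 fun e => MvPolynomial.C ((e.sgn : ℝ) * η ^ e.a) * MvPolynomial.X e.cls)
      = stepVal d η t o := by
  cases o with
  | none => simp [stepVal]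
  | some e => simp [stepVal]

/-- The polynomial edge labels `C(± η^a) · X_cls` (and `0`) are affine. [folklore] -/
theorem walkDet_totalDegree_stepPoly {K : ℕ} (η : ℝ) (o : Option (WEdge K)) :
    (o.elim 0 fun e => MvPolynomial.C ((e.sgn : ℝ) * η ^ e.a) * MvPolynomial.X e.cls
      : MvPolynomial (Fin K) ℝ).totalDegree ≤ 1 := by
  cases o with
  | none => simp
  | some e =>
      refine (MvPolynomial.totalDegree_mul _ _).trans ?_
      rw [MvPolynomial.totalDegree_C, MvPolynomial.totalDegree_X, zero_add]

/-- path determinant — an affine matrix `I − Z₀ − W·u vᵀ` whose determinant on the monomial curve is `1 − W·pathSum` [folklore] -/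
theorem stub_walkDet : ∀ (V : Type) [Fintype V] [DecidableEq V] (K : ℕ) (d : Fin K → ℕ) (g : List (WLayer V K)) (v₀ : V) (η W : ℝ), ∃ A : Matrix (Fin ((g.length + 1) * Fintype.card V)) (Fin ((g.length + 1) * Fintype.card V)) (MvPolynomial (Fin K) ℝ), (∀ i j, (A i j).totalDegree ≤ 1) ∧ ∀ t : ℝ, (A.map (MvPolynomial.eval fun l => t ^ d l)).det = 1 - W * pathSum d η t g v₀ := by
  intro V _ _ K d g v₀ η W
  have hcard : Fintype.card (V × Fin (g.length + 1)) = (g.length + 1) * Fintype.card V := by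
    rw [Fintype.card_prod, Fintype.card_fin, mul_comm]
  -- the blocks: corner (time `0`) and the layers in reversed time order
  set X : Fin (g.length + 1) → Matrix V V (MvPolynomial (Fin K) ℝ) :=
    Fin.cons
      (Matrix.of fun _ v' => if v' = v₀ then MvPolynomial.C (-((-1 : ℝ) ^ g.length * W)) else 0)
      (fun i => Matrix.of fun v v' => ((g.get (Fin.rev i)) v v').elim 0
        fun e => MvPolynomial.C ((e.sgn : ℝ) * η ^ e.a) * MvPolynomial.X e.cls) with hX
  refine ⟨Matrix.reindex (Fintype.equivFinOfCardEq hcard) (Fintype.equivFinOfCardEq hcard)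
      (1 + cyclicSub X), ?_, ?_⟩
  · -- affine entries
    intro i j
    rw [Matrix.reindex_apply, Matrix.submatrix_apply]
    refine walkDet_totalDegree_le X (fun s v v' => ?_) _ _
    refine Fin.cases ?_ (fun i => ?_) s
    · simp only [hX, Fin.cons_zero, Matrix.of_apply]
      split_ifs
      · exact (MvPolynomial.totalDegree_C _).trans_le zero_le_one
      · simp
    · simp only [hX, Fin.cons_succ, Matrix.of_apply]
      exact walkDet_totalDegree_stepPoly η _
  · -- the determinant on the monomial curve
    intro t
    have hmap : (Matrix.reindex (Fintype.equivFinOfCardEq hcard) (Fintype.equivFinOfCardEq hcard)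
        (1 + cyclicSub X)).map (MvPolynomial.eval fun l => t ^ d l)
        = Matrix.reindex (Fintype.equivFinOfCardEq hcard) (Fintype.equivFinOfCardEq hcard)
            ((1 + cyclicSub X).map (MvPolynomial.eval fun l => t ^ d l)) := rfl
    rw [hmap, Matrix.det_reindex_self, walkDet_map_one_add_cyclicSub,
      walkDet_det_cyclic _ ((g.map (layerMat d η t)).prod) v₀ (-((-1 : ℝ) ^ g.length * W))]
    · have h1 : (-1 : ℝ) ^ g.length * (-1) ^ g.length = 1 := by
        rw [← mul_pow, neg_one_mul, neg_neg, one_pow]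
      unfold pathSum
      linear_combination (-(W * ∑ x, (g.map (layerMat d η t)).prod v₀ x)) * h1
    · ext v v'
      simp only [hX, Fin.cons_zero, Matrix.map_apply, Matrix.of_apply]
      split_ifs <;> simp
    · have hL : (fun i : Fin g.length => (X i.succ).map (MvPolynomial.eval fun l => t ^ d l))
          = fun i => layerMat d η t (g.get (Fin.rev i)) := by
        funext i
        ext v v'
        simp only [hX, Fin.cons_succ, Matrix.map_apply, Matrix.of_apply, layerMat_apply]
        exact walkDet_eval_stepPoly d η t _
      rw [hL, walkDet_ofFn_rev_get]

end Summit.ValiantsHypothesis.ValiantsHypothesis.Theorems.SymmetroidDescartes.DPR
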